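import Summits.ABC.IUTFork.Cor312Provenance
import Literature.IUT.LogVolume.PilotDivisors
import Literature.NumberTheory.DiophantineGeometry.LocalReductionFiniteBadPlacesProofs
import HarnessLib

/-!
# [IUTchIII] Cor. 3.12 provenance, DH side: `log(q)` of the initial Θ-data IS the degree of Dupuy–Hilado's q-divisor (c312 crew, wave 2, W2-F companion)

Record-only companion (seat abc-iut-c312-8; board row W2-F) of `Cor312Provenance.lean`, TAKES NO SIDE. It links the
[IUTchI]/[IUTchIV] side of the `q`-parameter data — abc-iut-L5-t2's `InitialThetaData` ([IUTchI] Def. 3.1 (c):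
`ord_v(q_v)` = `qParamOrd`, `𝕍(F)^bad` = `VFbad`) and `Cor312Prov.logq D` ([IUTchIV] Thm. 1.10, p. 23: "`log(q) :=
deg(𝔮^{F□}_{ADiv})`") — to the Dupuy–Hilado side used by the cell's DH form of Cor. 3.12 — abc-iut-c312-3's
`Literature.IUT.LogVolume.PilotData` (DH §3.3: `(F, j_E, S, l)`, `ord_v(q_v) := −ord_v(j_E)`, `qDivisor = Σ_{v∈S}
ord_v(q_v)[v]`, `P_q = (1/2l)·𝔮`, `deg_qDivisor_pos`), as plan's precision P1 (INBOX 19:28:44Z) suggested: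
* `IsPilotDataOf D X : Prop` — the DH pilot datum `X` is THE ONE of `D`: same prime `l`, `S = 𝕍(F)^bad` (through
  Mathlib's `FinitePlace.maximalIdeal`), and DH's `ord_v(q_v) = −ord_v(j_E)` equals [IUTchI]'s `ord_v(q_v)` (:=
  `ord_v(Δ_min)`, Tate uniformisation — the classical identity `ord_v(Δ_min) = −ord_v(j_E) > 0` at a place of
  multiplicative reduction, Silverman ATAEC V.5.1 / VII.5.1, is exactly this hypothesis field; the tree records
  the FACT side in `MinimalDiscriminant.lean`);
* consequences, all PROVED: `VFbad_finite_of` (the finiteness field of `IsSettingOf`), `logq_eq_ndeg_qDivisor`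
  (`log(q) = deĝ̲_F(𝔮)`), `absLogq_eq_ndeg_qPilot` (`|log(q)| = deĝ̲_F(P_q)`), `logq_pos_of` (`log(q) > 0` — the input
  `Thm110Inputs.logq_pos` / `NumericsInputs.logq_pos` DISCHARGED from the DH datum: "`𝕍^bad ≠ ∅`", `deg_qDivisor_pos`),
  and `absLogQPos_of` (c312-7's printed clause "`|log(q)| > 0`", `Cor312.Setting.AbsLogQPos`, for any setting
  linked to `D` by `IsSettingOf`).
[claim: Mochizuki2012, status: disputed] / [cite: DupuyHilado2025, §3.3] for the quoted conventions; "typed" ≠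
"discharged" except where a theorem says PROVED.
-/

noncomputable section

namespace Summit.ABC.IUTFork.Cor312Prov

open Literature.IUT.HodgeTheaters Literature.IUT.LogVolume NumberField IsDedekindDomain

universe u v w

variable {F : Type u} {K : Type v} {Fbar : Type w} [Field F] [NumberField F] [Field K] [NumberField K]
  [Algebra F K] [Field Fbar] [Algebra F Fbar] [Algebra K Fbar] {E : WeierstrassCurve F} [E.IsElliptic]
  {l : ℕ} {Pb : BadPlacePredicates K}

/-- **`𝕍(F)^bad` is finite**, for EVERY collection of initial Θ-data — PROVED (no hypothesis): a place of `F` over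
`𝕍^bad_mod` is a place of (bad) multiplicative reduction of `E_F` ([IUTchI] Def. 3.1 (b), L5-t2's
`multiplicative_over_VbadMod`), hence lies in the set of bad places, which is finite by the tree's DISCHARGED
classical fact `WeierstrassCurve.finite_badPlaces_holds` (Silverman AEC VII.5/VIII.1; proved in
`LocalReductionFiniteBadPlacesProofs.lean`), transported along Mathlib's injection `FinitePlace.maximalIdeal`.
So the field `IsSettingOf.VFbad_finite` of `Cor312Provenance.lean` is always available as `vFbad_finite D`.
[claim: Mochizuki2012, status: disputed] -/
theorem vFbad_finite (D : InitialThetaData F K Fbar E l Pb) : D.VFbad.Finite := by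
  have hbad : (E.badPlaces (𝓞 F)).Finite := WeierstrassCurve.finite_badPlaces_holds (𝓞 F) E
  have hpre : {v : FinitePlace F | v.maximalIdeal ∈ E.badPlaces (𝓞 F)}.Finite :=
    hbad.preimage FinitePlace.maximalIdeal_injective.injOn
  refine hpre.subset fun v hv => ?_
  show v.maximalIdeal ∈ E.badPlaces (𝓞 F)
  rw [WeierstrassCurve.mem_badPlaces_iff]
  exact (D.multiplicative_over_VbadMod v hv).not_hasGoodReductionAt

/-- `log(q) = deĝ̲_F(𝔮^F_{ADiv})` with NO finiteness hypothesis left (the `finsum` of `Cor312Prov.logq` is a finite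
sum): `Cor312Prov.logq_eq_ndeg` at `vFbad_finite D`. PROVED. [claim: Mochizuki2012, status: disputed] -/
theorem logq_eq_ndeg_qArithDivisor (D : InitialThetaData F K Fbar E l Pb) :
    logq D = FinDivisor.ndeg F (qArithDivisor D (vFbad_finite D)) :=
  logq_eq_ndeg D (vFbad_finite D)

/-- **`IsPilotDataOf D X`**: the Dupuy–Hilado pilot datum `X = (F, j_E, S, l)` (c312-3's `PilotData F`, DH §3.3) is
the one attached to the initial Θ-data `D` ([IUTchI] Def. 3.1): (1) the same auxiliary prime `l` (DH "fixing `l` a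
prime number" / Def. 3.1 (c)); (2) `S` = "the places of bad multiplicative reduction" = `𝕍(F)^bad := 𝕍^bad_mod ×_{𝕍_mod}
𝕍(F)` (Def. 3.1 (b),(c); [IUTchIV] p. 23), compared through `FinitePlace.maximalIdeal`; (3) DH's "`ord_v(q_v) =
−ord_v(j_E)`" (§3.2–3.3, `PilotData.ordq`) equals [IUTchI] Def. 3.1 (c)'s "orders of the `q`-parameters" (L5-t2's
`qParamOrd := ord_v(Δ_min)`; the identity `ord_v(Δ_min) = −ord_v(j_E)` at multiplicative `v` is Tate uniformisation,
classical). HYPOTHESIS structure; no existence asserted. [cite: DupuyHilado2025, §3.3] -/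
structure IsPilotDataOf (D : InitialThetaData F K Fbar E l Pb) (X : PilotData F) : Prop where
  /-- same prime `l` -/
  l_eq : X.l = l
  /-- `S = 𝕍(F)^bad` -/
  mem_S_iff : ∀ v : FinitePlace F, v.maximalIdeal ∈ X.S ↔ v ∈ D.VFbad
  /-- `−ord_v(j_E) = ord_v(q_v)` at `v ∈ 𝕍(F)^bad` -/
  ordq_eq : ∀ v : FinitePlace F, v ∈ D.VFbad → X.ordq v.maximalIdeal = (qParamOrd E v.maximalIdeal : ℤ)

variable {D : InitialThetaData F K Fbar E l Pb} {X : PilotData F}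

/-- Under the link, `𝕍(F)^bad` is the preimage of the finite set `S` under the bijection "finite place ↦ maximal
ideal", hence FINITE — the field `IsSettingOf.VFbad_finite` discharged from the DH datum. PROVED.
[cite: DupuyHilado2025, §3.3] -/
theorem VFbad_finite_of (h : IsPilotDataOf D X) : D.VFbad.Finite := by
  have hset : D.VFbad = (fun v : FinitePlace F => v.maximalIdeal) ⁻¹' (X.S : Set (HeightOneSpectrum (𝓞 F))) := by
    ext v; simp [h.mem_S_iff]
  rw [hset]
  exact (X.S.finite_toSet).preimage (FinitePlace.maximalIdeal_injective.injOn)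

/-- The degree identity behind `log(q) = deĝ̲(𝔮)`: summing `ord_v(q_v)·log N(v)` over `𝕍(F)^bad` (finite places of `F`)
is summing DH's `ord_v(q_v)·ln|κ(v)|` over `S` (maximal ideals). PROVED (reindex along `v ↦ v.maximalIdeal`).
[cite: DupuyHilado2025, §3.3] -/
theorem sum_VFbad_eq_deg_qDivisor (h : IsPilotDataOf D X) (hfin : D.VFbad.Finite) :
    ∑ v ∈ hfin.toFinset, (qParamOrd E v.maximalIdeal : ℝ) * logNorm F v.maximalIdeal
      = FinDivisor.deg F X.qDivisor := by
  rw [PilotData.deg_qDivisor]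
  refine Finset.sum_bij (fun v _ => v.maximalIdeal) ?_ ?_ ?_ ?_
  · intro v hv
    exact (h.mem_S_iff v).mpr (hfin.mem_toFinset.mp hv)
  · intro v₁ _ v₂ _ heq
    exact FinitePlace.maximalIdeal_injective heq
  · intro w hw
    refine ⟨FinitePlace.mk w, ?_, FinitePlace.maximalIdeal_mk w⟩
    rw [Set.Finite.mem_toFinset, ← h.mem_S_iff, FinitePlace.maximalIdeal_mk]
    exact hw
  · intro v hv
    rw [h.ordq_eq v (hfin.mem_toFinset.mp hv)]
    push_cast
    rfl

/-- **`log(q) = deĝ̲_F(𝔮)`**: the [IUTchIV] quantity `log(q)` of the initial Θ-data (`Cor312Prov.logq D`) IS the normalized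
Arakelov degree of Dupuy–Hilado's `q`-divisor `𝔮 = Σ_{v∈S} ord_v(q_v)[v]` (c312-3's `PilotData.qDivisor`, `FinDivisor.ndeg`).
PROVED. [cite: DupuyHilado2025, §3.3] -/
theorem logq_eq_ndeg_qDivisor (h : IsPilotDataOf D X) : logq D = FinDivisor.ndeg F X.qDivisor := by
  have hfin := VFbad_finite_of h
  rw [logq_eq_ndeg D hfin, FinDivisor.ndeg_apply, FinDivisor.ndeg_apply, qArithDivisor, FinDivisor.deg_sum_of,
    sum_VFbad_eq_deg_qDivisor h hfin]

/-- **`log(q) > 0`** for the initial Θ-data, DISCHARGED from the DH datum ("`𝕍(F□)^bad … (≠ ∅)`", [IUTchIV] p. 23; DH: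
`S ≠ ∅`, `ord_v(q_v) > 0`, `ln|κ(v)| > 0` — c312-3's `deg_qDivisor_pos`): the input `Thm110Inputs.logq_pos` /
`NumericsInputs.logq_pos` of `Cor312Provenance.lean` holds. PROVED. [cite: DupuyHilado2025, §3.3] -/
theorem logq_pos_of (h : IsPilotDataOf D X) : 0 < logq D := by
  rw [logq_eq_ndeg_qDivisor h, FinDivisor.ndeg_apply]
  exact div_pos X.deg_qDivisor_pos FinDivisor.finrank_pos

/-- **`|log(q)| = deĝ̲_F(P_q)`**: `(1/2l)·log(q)` of the initial Θ-data is the normalized degree of Dupuy–Hilado's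
`q`-pilot divisor `P_q = (1/2l)·𝔮` (c312-3's `PilotData.qPilot`; their "`−|log(q)| = −deĝ(P_q)`" dictionary, skel
`ForkPilots.negAbsLogq_eq_neg_deg_qPilot`, now over the datum). PROVED. [cite: DupuyHilado2025, §3.3] -/
theorem absLogq_eq_ndeg_qPilot (h : IsPilotDataOf D X) : absLogq D = FinDivisor.ndeg F X.qPilot := by
  rw [absLogq, logq_eq_ndeg_qDivisor h, FinDivisor.ndeg_apply, FinDivisor.ndeg_apply, PilotData.deg_qPilot,
    h.l_eq]
  ring

/-- Cor. 3.12's printed clause "In particular, `|log(q)| > 0`" (c312-7's `Cor312.Setting.AbsLogQPos`) for ANY setting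
`P` that is the situation of `D` (`IsSettingOf D P`), DISCHARGED from the DH datum of `D`. PROVED.
[claim: Mochizuki2012, status: disputed] -/
theorem absLogQPos_of {T : Thm311.ThetaIndex} {S : Thm311.Situation T} {P : Cor312.Setting S}
    (hS : IsSettingOf D P) (h : IsPilotDataOf D X) : P.AbsLogQPos :=
  (absLogQPos_iff P hS (le_trans (by norm_num) D.five_le_l)).mpr (logq_pos_of h)

end Summit.ABC.IUTFork.Cor312Prov

end
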